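import Literature.Topology.FourManifolds.ConeShadow
import Literature.Topology.FourManifolds.ConeComplex
import Literature.Analysis.Convexity.SimplexTriangulationPure
import HarnessLib

/-!
# The cone shadow as a finite simplicial complex

Repackaging of `exists_coneShadow_triangulation` (`ConeShadow.lean`: Rushing 1973, Lemma 1.6.3 +
Exercise 1.6.12 for one simplex `conv T = a * B`, via cone shadows) in the form consumed by the
induction on `r` of the topological engulfing theorem (Rushing, proof of Thm. 4.12.1, Fact 2:
"the inductive hypothesis on `r` may be applied" to the shadow, a polyhedron of dimension
`≤ r - 1`): the set `a * K₀ ⊇ horn ∪ (conv T ∩ ⋃ A_ℓ)` to be engulfed *before* the stretch is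
the underlying space of a **finite geometric simplicial complex** `P` — the cone complex
(`coneComplex`, `ConeComplex.lean`) from the apex `a` over the subcomplex `K₀` — together with a
down-closed subfamily `Q` of faces whose polyhedron lies in the horn (already engulfed) such
that every face outside `Q` has at most `d + 2` vertices when the singular subspaces `A_ℓ` have
dimension `≤ d` (so `P` has relative dimension `≤ d + 1 = r - 1` for `d = r - 2`).

* `exists_shadowComplex` — the statement above, with the stretch clause of
  `exists_coneShadow_triangulation` carried along (`P.space ⊆ O` suffices to stretch `O` over
  `conv T`, fixed on any closed `F` meeting `conv T` inside `P.space`, with compact support in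
  any open `N ⊇ conv T`).

Everything is proved; no definitions, no named facts.

## References

* T. B. Rushing, *Topological Embeddings*, Academic Press (1973), Lemma 1.6.3, Exercise 1.6.12,
  and the proof of Thm. 4.12.1 (Fact 2). [Rushing1973]
-/

open Set Function Module

noncomputable section

namespace Literature.Topology.FourManifolds

open Literature.Analysis.Convexity

variable {E : Type*} [NormedAddCommGroup E] [NormedSpace ℝ E] [FiniteDimensional ℝ E]
  [DecidableEq E]

omit [FiniteDimensional ℝ E] in
/-- A vertex of an affinely independent set is off the affine span of the others. [folklore] -/
theorem notMem_affineSpan_erase {T : Finset E} (hT : AffineIndependent ℝ ((↑) : T → E)) {a : E}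
    (ha : a ∈ T) : a ∉ affineSpan ℝ ((T.erase a : Finset E) : Set E) := by
  have h := hT.notMem_affineSpan_sdiff ⟨a, ha⟩ (Set.univ : Set ↥T)
  have himg : ((↑) : ↥T → E) '' (Set.univ \ {⟨a, ha⟩}) = ((T.erase a : Finset E) : Set E) := by
    ext x
    simp only [mem_image, Set.mem_sdiff, Set.mem_univ, Set.mem_singleton_iff, true_and,
      Finset.coe_erase, Finset.mem_coe]
    constructor
    · rintro ⟨⟨y, hy⟩, hne, rfl⟩
      exact ⟨hy, fun h => hne (Subtype.ext h)⟩
    · rintro ⟨hx, hne⟩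
      exact ⟨⟨x, hx⟩, fun h => hne (congrArg Subtype.val h), rfl⟩
  rwa [himg] at h

omit [FiniteDimensional ℝ E] in
/-- The apex lies in the horn of a simplex with a nonempty free face. [folklore] -/
theorem apex_mem_simplexHorn {T : Finset E} {a : E} (ha : a ∈ T) (hB : (T.erase a).Nonempty) :
    a ∈ simplexHorn T a := by
  obtain ⟨b, hb⟩ := hB
  refine mem_iUnion₂.2 ⟨b, hb, subset_convexHull ℝ _ ?_⟩
  rw [Finset.coe_erase]
  exact ⟨Finset.mem_coe.2 ha, fun h => (Finset.mem_erase.1 hb).1 (h.symm ▸ rfl)⟩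

/-- **The cone shadow as a finite simplicial complex.**  For an affinely independent simplex
`T` with vertex `a` and nonempty free face, and finitely many affine subspaces `A_ℓ` of
dimension `≤ d` (the carriers of the singular cells), there are a finite geometric simplicial
complex `P` and a down-closed subfamily `Q ⊆ P.faces` such that: faces outside `Q` have
`≤ d + 2` vertices; the polyhedron of `Q` lies in the horn of `T` at `a`; `P.space` contains the
horn and every `conv T ∩ A_ℓ` and is contained in `conv T`; and every open `O ⊇ P.space`
stretches over `conv T` by a homeomorphism fixed on any closed `F` with
`F ∩ conv T ⊆ P.space` and supported in any open `N ⊇ conv T`.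
[cite: Rushing1973, Lemma 1.6.3 and Exercise 1.6.12; proof of Thm. 4.12.1, Fact 2] -/
theorem exists_shadowComplex {T : Finset E} (hT : AffineIndependent ℝ ((↑) : T → E))
    {a : E} (ha : a ∈ T) (hB : (T.erase a).Nonempty) {κ : Type*} [Fintype κ]
    (A : κ → AffineSubspace ℝ E) {d : ℕ} (hd : ∀ ℓ, finrank ℝ (A ℓ).direction ≤ d) :
    ∃ (P : Geometry.SimplicialComplex ℝ E) (Q : Set (Finset E)), P.faces.Finite ∧ Q ⊆ P.faces ∧
      (∀ s ∈ Q, ∀ t ⊆ s, t.Nonempty → t ∈ Q) ∧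
      (∀ s ∈ P.faces, s ∉ Q → s.card ≤ d + 2) ∧
      (⋃ s ∈ Q, convexHull ℝ (s : Set E)) ⊆ simplexHorn T a ∧
      simplexHorn T a ⊆ P.space ∧
      (∀ ℓ, convexHull ℝ (T : Set E) ∩ (A ℓ : Set E) ⊆ P.space) ∧
      P.space ⊆ convexHull ℝ (T : Set E) ∧
      ∀ F O N : Set E, IsClosed F → IsOpen O → IsOpen N →
        (∀ x ∈ F, x ∈ convexHull ℝ (T : Set E) → x ∈ P.space) → P.space ⊆ O →
        convexHull ℝ (T : Set E) ⊆ N →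
        ∃ G : E ≃ₜ E, (∀ x ∈ F, G x = x) ∧
          (∃ C : Set E, IsCompact C ∧ C ⊆ N ∧ ∀ x, x ∉ C → G x = x) ∧
          convexHull ℝ (T : Set E) ⊆ G '' O := by
  obtain ⟨K, K₀, hfin, hKsp, hK₀, hdown, hhorn, hsing, hkind, hconeK, hstretch⟩ :=
    exists_coneShadow_triangulation hT ha hB A
  -- the subcomplex `K₀` and its cone from `a`
  have hdown' : ∀ s ∈ K₀, ∀ t ⊆ s, t.Nonempty → t ∈ K₀ := fun s hs t hts htne =>
    hdown s hs t (K.down_closed (hK₀ hs) hts htne) hts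
  set K' := subcomplexOf K K₀ hK₀ hdown' with hK'
  have hK'faces : K'.faces = K₀ := rfl
  set Paff : AffineSubspace ℝ E := affineSpan ℝ ((T.erase a : Finset E) : Set E) with hPaff
  have hvertP : ∀ τ ∈ K'.faces, ((τ : Finset E) : Set E) ⊆ (Paff : Set E) := fun τ hτ x hx => by
    have hxK : x ∈ K.space := Geometry.SimplicialComplex.mem_space_iff.2
      ⟨τ, hK₀ hτ, subset_convexHull ℝ _ hx⟩
    rw [hKsp] at hxK
    exact (convexHull_min (subset_affineSpan ℝ _) Paff.convex) hxK
  have haP : a ∉ Paff := notMem_affineSpan_erase hT ha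
  have hvis : VisibleFrom a K' := visibleFrom_of_subset_affineSubspace hvertP haP
  set P := coneComplex a K' hvis with hP
  have hPsp : P.space = coneOver a K₀ := by
    rw [hP, coneComplex_space]; rfl
  -- the subfamily of faces inside the horn
  set Qb : Set (Finset E) := {τ | τ ∈ K₀ ∧ convexHull ℝ (↑(insert a τ) : Set E) ⊆ simplexHorn T a}
    with hQb
  set Q : Set (Finset E) := Qb ∪ (insert a) '' Qb ∪ {{a}} with hQ
  have haK₀ : ∀ τ ∈ K₀, a ∉ τ := fun τ hτ => hvis.apex_notMem hτ
  refine ⟨P, Q, coneComplex_faces_finite hvis (hfin.subset hK₀), ?_, ?_, ?_, ?_, ?_, ?_, ?_, ?_⟩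
  · -- `Q ⊆ P.faces`
    rintro s ((⟨hs, -⟩ | ⟨τ, ⟨hτ, -⟩, rfl⟩) | hs)
    · exact subset_coneComplex_faces a K' hvis hs
    · exact insert_mem_coneComplex_faces hvis hτ
    · rw [mem_singleton_iff.1 hs]; exact Or.inr (mem_singleton _)
  · -- down-closed
    rintro s hs t hts htne
    rcases hs with ((⟨hs, hsh⟩ | ⟨τ, ⟨hτ, hτh⟩, rfl⟩) | hs)
    · refine Or.inl (Or.inl ⟨hdown' s hs t hts htne, (convexHull_mono ?_).trans hsh⟩)
      rw [Finset.coe_insert, Finset.coe_insert]; exact insert_subset_insert (Finset.coe_subset.2 hts)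
    · by_cases hat : a ∈ t
      · rcases (t.erase a).eq_empty_or_nonempty with h0 | hne
        · have : t = {a} := by rw [← Finset.insert_erase hat, h0]; rfl
          exact Or.inr (mem_singleton_iff.2 this)
        · have hsub : t.erase a ⊆ τ := fun x hx => by
            have hx' := Finset.mem_erase.1 hx
            exact (Finset.mem_insert.1 (hts hx'.2)).resolve_left hx'.1
          refine Or.inl (Or.inr ⟨t.erase a, ⟨hdown' τ hτ _ hsub hne, (convexHull_mono ?_).trans hτh⟩,
            Finset.insert_erase hat⟩)
          rw [Finset.coe_insert, Finset.coe_insert]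
          exact insert_subset_insert (Finset.coe_subset.2 hsub)
      · have hsub : t ⊆ τ := fun x hx =>
          (Finset.mem_insert.1 (hts hx)).resolve_left fun h => hat (h ▸ hx)
        refine Or.inl (Or.inl ⟨hdown' τ hτ t hsub htne, (convexHull_mono ?_).trans hτh⟩)
        rw [Finset.coe_insert, Finset.coe_insert]; exact insert_subset_insert (Finset.coe_subset.2 hsub)
    · rw [mem_singleton_iff.1 hs] at hts
      have : t = {a} := Finset.Subset.antisymm hts (Finset.singleton_subset_iff.2 (by
        obtain ⟨x, hx⟩ := htne; rwa [Finset.mem_singleton.1 (hts hx)] at hx))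
      exact Or.inr (mem_singleton_iff.2 this)
  · -- card bound outside `Q`
    intro s hs hsQ
    rcases hs with (hs | ⟨τ, hτ, rfl⟩) | hs
    · -- a base face not of horn kind is of the second kind
      change s ∈ K₀ at hs
      rcases hkind s hs with h | ⟨ℓ, -, hcard⟩
      · exact absurd (Or.inl (Or.inl ⟨hs, h⟩)) hsQ
      · exact (hcard.trans (Nat.succ_le_succ (hd ℓ))).trans (Nat.le_succ _)
    · change τ ∈ K₀ at hτ
      rcases hkind τ hτ with h | ⟨ℓ, -, hcard⟩
      · exact absurd (Or.inl (Or.inr ⟨τ, ⟨hτ, h⟩, rfl⟩)) hsQ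
      · rw [Finset.card_insert_of_notMem (haK₀ τ hτ)]
        exact Nat.succ_le_succ (hcard.trans (Nat.succ_le_succ (hd ℓ)))
    · exact absurd (Or.inr hs) hsQ
  · -- polyhedron of `Q` inside the horn
    refine iUnion₂_subset fun s hs => ?_
    rcases hs with ((⟨-, hsh⟩ | ⟨τ, ⟨-, hτh⟩, rfl⟩) | hs)
    · refine (convexHull_mono ?_).trans hsh
      rw [Finset.coe_insert]; exact subset_insert a _
    · exact hτh
    · rw [mem_singleton_iff.1 hs, Finset.coe_singleton, convexHull_singleton, singleton_subset_iff]
      exact apex_mem_simplexHorn ha hB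
  · rw [hPsp]; exact hhorn
  · rw [hPsp]; exact hsing
  · rw [hPsp, ← hconeK]; exact coneOver_mono a hK₀
  · intro F O N hF hO hN hFP hPO hTN
    rw [hPsp] at hFP hPO
    exact hstretch F O N hF hO hN hFP hPO hTN

end Literature.Topology.FourManifolds
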